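import Summits.Ventures.PercRepro.Night2NonFatColoopIndep

/-!
# night-2: the NON-FAT case of (FAIR) — the sharp coloop sum (gen 37)

The sum over the coloop points `y` (`rk (W ∖ y) ≤ 3`) of the sharp terms `1 / (2 · phiM (m₀ y) · #indepPairs y)` — `m₀ y` any
lower bound on the number of points missed by the member faces inside `Q ∪ {y}`, `indepPairs y` the pairs of `(T ∖ K) ∖ cl (W ∖ y)`
independent modulo `W ∖ y` — settles the pair as soon as it reaches `1` (**`basis_pair_fair_of_coloop_sum_indep`**): the criterion
of the census (mining/night-2/g37/j332637: «coloop-phi-indep»).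
Paper: proofs/NIGHT-2-g37.md §2.
-/

namespace PercRepro.Shadow

open PercRepro.ThmH PercRepro.PerFlat

variable {α : Type*} [DecidableEq α] {M : Matroid α} [M.Finite] {G : Finset α}

open scoped Classical in
/-- **The sharp coloop sum**: `1 ≤ Σ_{y coloop point} 1 / (2 · phiM (m₀ y) · #indepPairs y)` gives the fair share. -/
theorem basis_pair_fair_of_coloop_sum_indep (hG : G ∈ flatsQ M (5 + 1)) (hd : (gr M \ G).card = 2)
    (hk : kColoops M G = 1) (hs : ∀ e ∈ gr M, ∀ f ∈ gr M, e ≠ f → rkN M {e, f} = 2)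
    (hl : ∀ e ∈ gr M, M.Indep {e}) (hfat : (fatClosures M 5 G 2).card ≤ 1) {B : Finset α}
    (hB : B ∈ thinMembers M 5 G) (hnP : ¬ bigP M G B) {z : α} (hz : z ∈ G \ clF M B)
    (hl0 : loss M 5 G B z ≠ 0) (m₀ : α → ℕ)
    (hm : ∀ y ∈ G \ insert z B, rkN M ((G \ insert z B).erase y) ≤ 3 →
      ∀ B' ∈ thinMembers M 5 G, ¬ bigP M G B' → B' ⊆ insert y (insert z B) → m₀ y ≤ (G \ clF M B').card)
    (hsum : 1 ≤ ∑ y ∈ (G \ insert z B).filter (fun y => rkN M ((G \ insert z B).erase y) ≤ 3),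
      1 / (2 * phiM (m₀ y) * ((indepPairs M G B z y).card : ℚ))) :
    loss M 5 G B z ≤ rhoL M 5 G B z * lossIncomeH M 5 G (bigP M G) (dshGT2 M 5 G) B z := by
  apply basis_pair_fair_of_level_one_sum hG hd hk hs hl hfat hB hnP hz hl0
  calc (1 : ℚ) ≤ ∑ y ∈ (G \ insert z B).filter (fun y => rkN M ((G \ insert z B).erase y) ≤ 3),
        1 / (2 * phiM (m₀ y) * ((indepPairs M G B z y).card : ℚ)) := hsum
    _ ≤ ∑ y ∈ (G \ insert z B).filter (fun y => rkN M ((G \ insert z B).erase y) ≤ 3),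
        vCap M G (insert y (insert z B)) / faceSum M G (insert y (insert z B)) := by
        apply Finset.sum_le_sum
        intro y hy
        rw [Finset.mem_filter] at hy
        exact level_one_term_ge_of_coloop_indep hG hd hk hs hl hB hnP hz hl0 hy.1 hy.2 (hm y hy.1 hy.2)
    _ ≤ ∑ y ∈ G \ insert z B, vCap M G (insert y (insert z B)) / faceSum M G (insert y (insert z B)) := by
        apply Finset.sum_le_sum_of_subset_of_nonneg (Finset.filter_subset _ _)
        intro y hy _
        apply div_nonneg (vCap_nonneg _)
        exact (faceSum_pos_of_mem_tgtSets hG hd hk hB hnP hz hl0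
          (level_one_targets_subset hG hB hz (Finset.mem_image.2 ⟨y, hy, rfl⟩))).le

end PercRepro.Shadow
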